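import Literature.Computation.Certificates.KeyedTableStreamIds
import Mathlib.Data.Real.Basic

/-!
# The K-STREAM lane: Gram-form Positivstellensatz certificates as sorted contribution streams

The assembly of `KeyedSparseStream` (sorted group-sum walk), `KeyedGramStream*` (the big free
block as an entry stream tied to a PSD twin) and `KeyedTableStream*` (multiplier products as
table contributions): the bridge from the `SOS.Poly` vocabulary of `SumOfSquares` / `GramSOS`
(`monoEval_keyOfMono`, `eval_keyedZ`), the decidable link of the families' hypothesis tables to the
client's lists (`linksOK`), the small blocks' certificates (`BlocksOK`), and the MAIN THEOREM
`SOS.Keyed.nonneg_of_kstream` — conclusion shape of `SOS.Poly.nonneg_of_checkG`: `p(x) ≥ 0`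
wherever every `g ∈ gs` is `≥ 0` and every `h ∈ hs` vanishes. Kernel smoke test: the 3 × 3
pure-Gram stream of `KeyedGramStreamWindows` through the main theorem over `ℝ`.
[cite: BlekhermanParriloThomas2012, Thm 3.39, p. 65 and Thm 3.127]; twin
[cite: Rump1999VerifiedLargeSystems, §4 Algorithm 4.1 step 7]; codes [cite: Harvey2009, §3.1].

HOW A CERTIFICATE USES IT (one identity): Data files (keys, twin rows, position/index/id tables,
family tables) + per-window files (`groupCheck`, `sidePass`, `tabSidePass`, entry count, each one
`decide +kernel`) + `pairPass` / `idPass` / twin `PSD.Packed.checkRows` / small blocks' `checkRows`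
+ the links and the target equality `keyedZ b Λ p = some (targets…)` by `decide`, then ONE
application of `nonneg_of_kstream`. Emitter: `certsdp.sos.kstream` (certnum cell).

WHAT THIS FILE IS NOT: not a decision procedure; not a statement about any dynamical system (the
client's Lyapunov/transport lemmas turn `p ≥ 0 on {g ≥ 0} ∩ {h = 0}` into their claims).
-/

namespace Literature.Computation.Certificates

namespace SOS

namespace Keyed

open PSD

/-! ### Bridge from `SOS.Poly` -/

section Bridge

variable {R : Type*} [Field R] [CharZero R]

omit [CharZero R] in
/-- **Kronecker codes are faithful on small exponents**: `monoEval` of `keyOfMono b m` is the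
monomial's value (`m.length ≤ n` digits, exponents `≤ D < b`). [cite: Harvey2009, §3.1] -/
theorem monoEval_keyOfMono (x : ℕ → R) {b D : ℕ} (hD : D < b) :
    ∀ (m : Monomial) (n i : ℕ), m.length ≤ n → (∀ e ∈ m, e ≤ D) →
      monoEval x b n i (keyOfMono b m) = Monomial.evalFrom x i m
  | [], n, i, _, _ => by rw [keyOfMono, monoEval_key_zero, Monomial.evalFrom_nil]
  | e :: es, 0, i, hlen, _ => by simp at hlen
  | e :: es, n + 1, i, hlen, hb => by
    have he : e < b := lt_of_le_of_lt (hb e (by simp)) hD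
    have hb0 : 0 < b := by omega
    have h1 : (e + b * keyOfMono b es) % b = e := by rw [Nat.add_mul_mod_self_left, Nat.mod_eq_of_lt he]
    have h2 : (e + b * keyOfMono b es) / b = keyOfMono b es := by
      rw [Nat.add_mul_div_left _ _ hb0, Nat.div_eq_of_lt he, zero_add]
    rw [keyOfMono, monoEval_succ, Monomial.evalFrom_cons, h1, h2,
      monoEval_keyOfMono x hD es n (i + 1) (by simpa using hlen) (fun e' he' => hb e' (by simp [he']))]

/-- A nonnegative/negative integer as sign–magnitude. [folklore] -/
private theorem sval_natAbs (z : ℤ) : sval (decide (0 ≤ z)) z.natAbs = z := by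
  unfold sval
  by_cases h : 0 ≤ z
  · rw [decide_eq_true h, if_pos rfl]; exact Int.natAbs_of_nonneg h
  · rw [decide_eq_false h]
    simp only [Bool.false_eq_true, if_false, Int.natCast_natAbs]
    rw [abs_of_neg (by omega)]; ring

/-- **The bridge**: the `Λ`-scaled keyed form of an `SOS.Poly` evaluates to `Λ · p(x)`.
[cite: Harvey2009, §3.1] -/
theorem eval_keyedZ (x : ℕ → R) {b D n Λ : ℕ} (hD : D < b) :
    ∀ (p : Poly) {T : STerms}, keyedZ b Λ p = some T → polyOK D n p = true →
      ZTerms.eval x b n (STerms.toZ T) = (Λ : R) * Poly.eval x p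
  | [], T, h, _ => by simp [keyedZ] at h; subst h; simp
  | (m, c) :: p, T, h, hok => by
    simp only [polyOK, List.all_cons, Bool.and_eq_true, decide_eq_true_eq, List.all_eq_true] at hok
    obtain ⟨⟨hlen, hexp⟩, hrest⟩ := hok
    unfold keyedZ at h
    cases hrec : keyedZ b Λ p with
    | none => rw [hrec] at h; exact absurd h (by simp)
    | some T' =>
      rw [hrec] at h
      simp only at h
      split at h
      · rename_i hden
        simp only [Option.some.injEq] at h
        subst h
        have ih := eval_keyedZ x hD p hrec (by simpa [polyOK] using hrest)
        rw [STerms.toZ_cons, ZTerms.eval_cons, ih, sval_natAbs, Poly.eval_cons,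
          monoEval_keyOfMono x hD m n 0 hlen hexp, ← Monomial.eval_eq]
        have hq : ((((Λ : ℚ) * c).num : ℤ) : R) = (Λ : R) * (c : R) := by
          have e1 : ((((Λ : ℚ) * c).num : ℚ)) = (Λ : ℚ) * c := Rat.coe_int_num_of_den_eq_one hden
          have e2 : ((((Λ : ℚ) * c).num : ℤ) : R) = ((((((Λ : ℚ) * c).num : ℤ) : ℚ)) : R) := by push_cast; rfl
          rw [e2, e1, Rat.cast_mul, Rat.cast_natCast]
        rw [hq]; ring
      · exact absurd h (by simp)

omit [CharZero R] in
/-- The concatenated window targets evaluate to the sum of the window values.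
[cite: BlekhermanParriloThomas2012, §3.1.4 eq. (3.12), p. 64] -/
theorem eval_flatten (x : ℕ → R) (b n : ℕ) :
    ∀ Ts : List STerms, ZTerms.eval x b n (STerms.toZ Ts.flatten) = (Ts.map fun T => ZTerms.eval x b n (STerms.toZ T)).sum
  | [] => by simp
  | T :: Ts => by rw [List.flatten_cons, toZ_append, ZTerms.eval_append, eval_flatten x b n Ts, List.map_cons, List.sum_cons]

end Bridge

/-! ### The main theorem of the lane -/

section Main

/-- **Links of the families' hypothesis tables to the client's lists** `gs` / `hs`, key digit bounds
of all tables, positive scales — one Boolean for all families.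
[cite: BlekhermanParriloThomas2012, Thm 3.39, p. 65] -/
def linksOK (b Dm n : ℕ) (t : TabCtx) (gs hs : List Poly) : Bool :=
  t.fams.all fun F =>
    decide (0 < F.D) && F.A.keysOK b Dm n && F.T.keysOK b Dm n &&
      (if F.ineq then
        decide (F.hyp < gs.length) && decide (keyedZ b F.D (gs.getD F.hyp []) = some F.T.toSTerms) &&
          polyOK Dm n (gs.getD F.hyp [])
      else
        decide (F.hyp < hs.length) && decide (keyedZ b F.D (hs.getD F.hyp []) = some F.T.toSTerms) &&
          polyOK Dm n (hs.getD F.hyp []))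

/-- **Integer Gram certificates of the small blocks** of the inequality families, as a conjunction
assembled by `⟨cert₀, cert₁, …, trivial⟩` (each e.g. `fun _ => ⟨_, _, _, PSD.Packed.isGramCertZ_of_checkRows (by decide +kernel)⟩`).
[cite: BlekhermanParriloThomas2012, Thm 3.39, p. 65] -/
def BlocksOK : List Family → Prop
  | [] => True
  | F :: Fs => (F.ineq = true → ∃ (m : ℕ) (dd : Fin m → ℕ) (B : Matrix (Fin m) (Fin F.A.n) ℤ),
      PSD.IsGramCertZ (PSD.Packed.intMatrixRows F.A.n F.wq F.Q) dd B) ∧ BlocksOK Fs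

/-- Membership form of `BlocksOK`. [folklore] -/
private theorem blocksOK_mem : ∀ {Fs : List Family}, BlocksOK Fs → ∀ F ∈ Fs, F.ineq = true →
    ∃ (m : ℕ) (dd : Fin m → ℕ) (B : Matrix (Fin m) (Fin F.A.n) ℤ),
      PSD.IsGramCertZ (PSD.Packed.intMatrixRows F.A.n F.wq F.Q) dd B
  | [], _, F, hF, _ => by simp at hF
  | F₀ :: Fs, h, F, hF, hi => by
    rcases List.mem_cons.mp hF with rfl | hF'
    · exact h.1 hi
    · exact blocksOK_mem h.2 F hF' hi

variable {R : Type*} [Field R] [LinearOrder R] [IsStrictOrderedRing R]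

/-- **Soundness of the K-STREAM lane (Gram-form Positivstellensatz certificates as sorted
contribution streams).** If the concatenated window targets are the `Λ`-scaled keyed form of `p`;
every window passes its group check, its Gram side pass and its table side pass; the pair pass and
the id pass accept on the total entry count; the basis keys, the table keys and `p`, `gs`, `hs` have
small digits; the twin's groups have the right shape and the twin (packed rows) and every small
block carry integer Gram certificates; the margin `s·e ≤ s₂` holds and `0 < S`, `0 < Λ`; and every
family's hypothesis table is the scaled keyed form of the hypothesis it names — then
`p(x) ≥ 0` at every point where all `g ∈ gs` are `≥ 0` and all `h ∈ hs` vanish.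
[cite: BlekhermanParriloThomas2012, Thm 3.39, p. 65; Rump1999VerifiedLargeSystems, §4 Algorithm 4.1 step 7] -/
theorem nonneg_of_kstream {p : Poly} {gs hs : List Poly} {b D Dm Dp n Λ P m : ℕ} {c : GramCtx}
    {d : SideCtx} {t : TabCtx} {e : TabSide} {W : List (List (ℕ × ℕ))} {Ts : List STerms}
    {dd : Fin m → ℕ} {B : Matrix (Fin m) (Fin c.s) ℤ}
    (htarget : keyedZ b Λ p = some Ts.flatten) (hp : polyOK Dp n p = true) (hDp : Dp < b) (hΛ : 0 < Λ)
    (hgroup : GroupOK c t.contrib W Ts) (hside : SideOK c d 0 W) (htside : TabSideOK c d t e 0 W)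
    (hP : (W.map fun w => (entries c w).length).sum = P) (hpair : pairPass c d P = true)
    (hid : idPass c d t e P = true) (hkeys : keysOK c b D n = true) (hD : D + D < b)
    (hgroups : groupsOK d.R d.Mrows = true)
    (hM : PSD.IsGramCertZ (PSD.Packed.intMatrixRows c.s d.wm d.Mrows.flatten) dd B)
    (hmargin : c.s * d.e ≤ d.s₂) (hS : 0 < d.S)
    (hlinks : linksOK b Dm n t gs hs = true) (hDm : Dm + Dm + Dm < b) (hblocks : BlocksOK t.fams)
    (x : ℕ → R) (hg : ∀ g ∈ gs, 0 ≤ Poly.eval x g) (hh : ∀ h ∈ hs, Poly.eval x h = 0) :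
    0 ≤ Poly.eval x p := by
  have hlen : (entries c (windowsChunks W)).length = P := by rw [length_entries_windowsChunks, hP]
  have hSA := sideAll_of_sideOK c d hside
  have hTA := tabSideAll_of_tabSideOK c d t e htside
  -- the window targets: total value
  have htot := sum_eval_targets x b n c t.contrib W Ts hgroup
  -- Gram part ≥ 0
  have hg0 := gsum_nonneg_of_isGramCertZ x hSA (hlen ▸ hpair) hkeys hD hgroups hM hmargin hS
  -- table part = Σ families ≥ 0
  have htab : (W.map fun w => tsum x b n t.contrib (entries c w)).sum =
      (t.fams.map fun F => ∑ l ∈ Finset.range F.size, cval x b n (F.contribLocal l)).sum := by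
    rw [sum_tsum_windows, tsum_eq_sum_fams x b n hSA hTA (hlen ▸ hid)]
  have hfams : 0 ≤ (t.fams.map fun F => ∑ l ∈ Finset.range F.size, cval x b n (F.contribLocal l)).sum := by
    refine List.sum_nonneg ?_
    intro v hv
    obtain ⟨F, hF, rfl⟩ := List.mem_map.mp hv
    simp only [linksOK, List.all_eq_true, Bool.and_eq_true, decide_eq_true_eq] at hlinks
    obtain ⟨⟨⟨hDpos, hAk⟩, hTk⟩, hlink⟩ := hlinks F hF
    cases hi : F.ineq with
    | false =>
      rw [hi] at hlink
      simp only [Bool.false_eq_true, if_false, Bool.and_eq_true, decide_eq_true_eq] at hlink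
      obtain ⟨⟨hhyp, hkz⟩, hok⟩ := hlink
      have hmem : hs.getD F.hyp [] ∈ hs := by
        rw [List.getD_eq_getElem _ _ hhyp]; exact List.getElem_mem hhyp
      simp only [F.sum_contrib_eq x hi hAk hTk (by omega), PTab.val, eval_keyedZ x (by omega) _ hkz hok,
        hh _ hmem, mul_zero, le_refl]
    | true =>
      rw [hi] at hlink
      simp only [if_true, Bool.and_eq_true, decide_eq_true_eq] at hlink
      obtain ⟨⟨hhyp, hkz⟩, hok⟩ := hlink
      obtain ⟨m', dd', B', hQ⟩ := blocksOK_mem hblocks F hF hi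
      refine F.sum_contrib_ineq_nonneg x hi hAk hTk hDm hQ ?_
      have hmem : gs.getD F.hyp [] ∈ gs := by
        rw [List.getD_eq_getElem _ _ hhyp]; exact List.getElem_mem hhyp
      rw [PTab.val, eval_keyedZ x (by omega) _ hkz hok]
      exact mul_nonneg (Nat.cast_nonneg _) (hg _ hmem)
  -- assemble
  have hall : 0 ≤ (Ts.map fun T => ZTerms.eval x b n (STerms.toZ T)).sum := by
    rw [htot, htab]; exact add_nonneg hg0 hfams
  have hev : (Ts.map fun T => ZTerms.eval x b n (STerms.toZ T)).sum = (Λ : R) * Poly.eval x p := by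
    rw [← eval_flatten, eval_keyedZ x hDp p htarget hp]
  rw [hev] at hall
  have hΛ' : (0 : R) < (Λ : R) := by exact_mod_cast hΛ
  exact le_of_mul_le_mul_left (by simpa using hall) hΛ'

end Main

/-! ### Smoke test (kernel): the 3 × 3 pure-Gram stream through the main theorem -/

section Tests

/-- test context (as in `KeyedGramStreamWindows`): `s = 3`, keys `0, 1, 16` [folklore] -/
private def pC : GramCtx := ⟨3, 2, 4, 4, 8, 1048832⟩
/-- test side data [folklore] -/
private def pD : SideCtx := ⟨2, 4, [[2170, 1959], [2680]], 4, [[784, 1056], [1280]], 8, [[2320]], [[2708]], 1, 1, 0, 0⟩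
/-- no product families [folklore] -/
private def pT : TabCtx := ⟨[], 0⟩
/-- empty id tables [folklore] -/
private def pE : TabSide := ⟨1, 1, 1, [], 1, []⟩
/-- the two windows [folklore] -/
private def pW : List (List (ℕ × ℕ)) := [[(3, 146718462208)], [(3, 36847427616)]]
/-- the two packed targets [folklore] -/
private def pTs : List STerms := [targets 8 4 [(3, 18694424019968)], targets 8 4 [(3, 4681659195408)]]
/-- the claim polynomial `2 − 2x₀ + 2x₀² + 0·x₁ − 2x₀x₁ + 2x₁²`, terms in key order [folklore] -/
private def pP : Poly := [([], 2), ([1], -2), ([2], 2), ([0, 1], 0), ([1, 1], -2), ([0, 2], 2)]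

/-- kernel test [folklore] -/
private theorem p_M : PSD.IsGramCertZ (PSD.Packed.intMatrixRows pC.s pD.wm pD.Mrows.flatten)
    (fun _ : Fin 0 => 0) (fun _ _ => 0) := by
  unfold PSD.IsGramCertZ; decide

/-- **End to end through `nonneg_of_kstream`** (no hypotheses: `gs = hs = []`). [folklore] -/
example (x : ℕ → ℝ) : 0 ≤ Poly.eval x pP :=
  nonneg_of_kstream (gs := []) (hs := []) (b := 16) (D := 1) (Dm := 2) (Dp := 2) (n := 2) (Λ := 1) (P := 6)
    (c := pC) (d := pD) (t := pT) (e := pE) (W := pW) (Ts := pTs)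
    (by decide +kernel) (by decide) (by norm_num) (by norm_num)
    ⟨by decide, by decide, trivial⟩ ⟨by decide, by decide, trivial⟩ ⟨by decide, by decide, trivial⟩
    (by decide) (by decide) (by decide) (by decide) (by norm_num) (by decide) p_M (by decide) (by decide)
    (by decide +kernel) (by norm_num) trivial x (by simp) (by simp)

end Tests


end Keyed

end SOS

end Literature.Computation.Certificates
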